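import Summits.QuantumFields.YangMills.Theorems.UnitScaleTiltProp7CombTildTrueLin
import Summits.QuantumFields.YangMills.Theorems.UnitScaleTiltProp7EmlFDerivConj
import Literature.MathematicalPhysics.QuantumFieldTheory.Balaban1983to89.B8Eq191FlatStencils
import HarnessLib

/-!
# Route `UnitScaleTilt`, crux K1 «MinimiserStabilityRegPr» (stmt-QuantumFields-19200), route-R E′ (A′)-on-Σ, P-A2 (β), row «(n3)-comb» —
# (O2) GROUNDWORK, file F-3: THE ONE-STEP TRUE DERIVATIVE OF PRINT's SINGLE BAR IS EXACT ON PURE GAUGES —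
# `T_{V₀}(∇^{V₀}φ)(c) = φ(c₋) − Ad_{V̄₀(c)} φ(c₊)` (the covariant coarse gradient of the potential restricted to the corners), BY ALGEBRA

«(O2) groundwork — not consumed by any displayed row before the freeze lifts» (★★OWNER `ym3-torus-plan` g29 RULINGS №20 (2), №22).
Cell `ym3-torus`, D-0154 (3c) R3 twin-width seat `ym-routeR-w1` (gen 9); DESIGN memo `DESIGN-N3COMB-LINEAR-CORE-routeRw1g9.md` (19200 evidence) §1 row 2, file list §5 F-3.
THEOREMS ONLY (0 `def`, 0 `sorry`); `--supports stmt-QuantumFields-19200 --as helper`, count-neutral.  YM₃ on T³ is a ladder rung (R3), not the Clay problem; nothing here claims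
`hMcomb`, `hMcomb₂`, (β), `hPA2`, `hcoS`, the stub, the crux, d = 4 or the mass gap.

THE POINT.  The structure theorem of the (n3)-comb design (★routeR-w6 g8 PREREAD §0 ∕ ★routeR-w4 g16 FLATCORE Lemma A: `Q⁽ᵏ⁾ = S⁽ᵏ⁾ + d(Ψ_k|corners)`) rests, at a curved
background, on ONE exact identity: the true one-step derivative `T_{V₀}` of print's single bar (65) — the operator of ✓`Prop7CombTildTrueLin.norm_tild_sub_one_sub_trueLin_le`
(p702302), `Y ↦ D eml(W₀)[r ↦ (R_{0,c₋}Y)(loop_r)·W₀,r]·κ₀⁻¹ + κ₀·(R_{0,c₋}Y)([c₋,c₊])·κ₀⁻¹` — maps the covariant gradient `∇^{V₀}φ(b) = φ(b₋) − Ad_{V₀(b)}φ(b₊)` of ANY site field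
`φ` to the covariant COARSE gradient `φ(c₋) − Ad_{V̄₀(c)}φ(c₊)`, EXACTLY (no remainder, any background whose block loops are in the unit window of the series logarithm).  This is the
cornered-comb twin of ✓`Prop7TrueLinPureGauge.trueLin_pureGauge` ([Balaban1984PropagatorsI] (1.20): the averaging maps pure gauges to pure gauges; print's (11) `(Ūᵘ) = Ūᵘ` linearised).
Mechanism (pure algebra): (i) covariant telescoping `(R_{0,x}∇^{V₀}φ)(Γ) = φ(x) − Ad_{V₀(Γ)}φ(x + disp Γ)` along every word (lit `tsum_cons`, both letter orientations); (ii) on a block loop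
this is the commutator direction `r ↦ φ·W₀,r − W₀,r·φ`, which `D eml(W₀)` maps to `φ·κ₀ − κ₀·φ` (✓`Prop7EmlFDerivConj.fderiv_eml_comm_of_norm_sub_one_lt`, the derivative of the exact
covariance (0.6)); (iii) `κ₀·V₀([c₋,c₊]) = V̄₀(c)` ((42)).

WHAT IS PROVED (ns `…Theorems.Prop7CombTildPureGauge`; `𝔸` any C⋆-algebra for §3, any normed ring for §1–§2; every `d`, `L`).
* §1 ★ `tsum_covGrad` — (i) for every word; `tsum_covGrad_of_disp_eq_zero` — closed words.
* §2 `tsum_covGrad_loop` (the block loops `Γ_{c,x} ∪ (−c)`), `tsum_covGrad_seg` (the segment `[c₋, c₊]`).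
* §3 ★★★ `trueLin_covGrad_eq` — the title; ★★ `trueLin_covGrad_eq_level` — the same read at level `j` of print's comb tower (`V₀ := Ū₀ʲ`, corner `q = L•z`, coarse bond `avgIter L U₀ (j+1) z κ`).
HONEST SCOPE.  Identities only; the window `‖W₀,r − 1‖ < 1` is displayed (at the member it is lit ✓`norm_Wcx_sub_one_le` at `RegPr`).  Nothing of Bałaban's is asserted beyond the cited tree∕lit theorems.

References: T. Bałaban, CMP **98** (1985) 17–51 [Balaban1985Averaging] ((11) p.19, (42) p.23, (58) p.27, (65) p.29, (119)–(120) p.35); CMP **95** (1984) 17–40 [Balaban1984PropagatorsI]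
((1.20) p.20); CMP **109** (1987) 249–301 [Balaban1987RG1] ((0.6) p.253).
-/

noncomputable section

open scoped BigOperators

namespace Summit.QuantumFields.YangMills.Theorems.Prop7CombTildPureGauge

open NormedSpace
open Literature.MathematicalPhysics.QuantumFieldTheory.Balaban1983to89
open ExpMeanLog (eml)
open B7Prop1Explicit (Site Letter e hol stepHol disp seg boxVec gammaWord Wcx Xavg bavg expUnit hol_cons Wcx_eq_hol_loop)
open B7Prop2Explicit (avgIter avgIter_succ rescale_apply)
open B7Eq78Linearization (conjR conjR_apply conjR_one conjR_add conjR_sub)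
open B7Prop3GeneralRotated (tsum tstep tsum_cons conjR_mul_left)
open B8Eq191FlatStencils (conjR_unitOne)
open Summit.QuantumFields.YangMills.Theorems.Prop7EmlFDerivConj (fderiv_eml_comm_of_norm_sub_one_lt)
open Summit.QuantumFields.YangMills.Theorems.Prop7CombTildTrueLin (coe_expUnit_Xavg_eq_eml expUnit_Xavg_eq)

section Telescoping

variable {d : ℕ} {𝔸 : Type*} [NormedRing 𝔸]

/-! ## §1 ★ Covariant telescoping of the covariant gradient along a word -/

/-- ★ **COVARIANT TELESCOPING**: for the covariant gradient `Y_b = φ(b₋) − Ad_{V₀(b)}φ(b₊)` of a site field `φ` and every word `Γ` from `x`,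
`(R_{0,x}Y)(Γ) = φ(x) − Ad_{V₀(Γ)}φ(x + disp Γ)` — the cornered∕`ℤᵈ` twin of ✓`Prop7CovLinAvgPureGauge.covWalkSum_pureGauge_walk`. [cite: Balaban1985Averaging, (58) p.27; Balaban1984PropagatorsI, (1.20) p.20] -/
theorem tsum_covGrad (V₀ : Site d → Fin d → 𝔸ˣ) (φ : Site d → 𝔸) (Y : Site d → Fin d → 𝔸)
    (hY : ∀ x μ, Y x μ = φ x - conjR (V₀ x μ) (φ (x + e μ))) :
    ∀ (x : Site d) (w : List (Letter d)), tsum V₀ Y x w = φ x - conjR (hol V₀ x w) (φ (x + disp w))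
  | x, [] => by simp [conjR_apply]
  | x, l :: w => by
    rw [tsum_cons, tsum_covGrad V₀ φ Y hY (x + l.vec) w, hol_cons, conjR_mul_left, B7Prop1Explicit.disp_cons, conjR_sub, ← add_assoc]
    -- it remains: `tstep V₀ Y x l + Ad_{g}(φ(x + vec l)) = φ x`, by cases on the orientation of `l`
    suffices h : tstep V₀ Y x l + conjR (stepHol V₀ x l) (φ (x + l.vec)) = φ x by
      rw [← h]; abel
    obtain ⟨μ, b⟩ := l
    cases b
    · -- backward letter: `tstep = −Ad_g Y(x − e_μ, μ)`, `g = V₀(x − e_μ, μ)⁻¹`, and `Y(x − e_μ, μ) = φ(x − e_μ) − Ad_{V₀(b)}φ(x)`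
      have hg : stepHol V₀ x (μ, false) = (V₀ (x + Letter.vec (μ, false)) μ)⁻¹ := by unfold stepHol; simp
      have hx : x + Letter.vec ((μ, false) : Letter d) + e μ = x := by simp
      unfold tstep
      simp only [Bool.false_eq_true, ↓reduceIte]
      rw [hY, hx, conjR_sub, hg, ← conjR_mul_left, inv_mul_cancel, conjR_unitOne]
      abel
    · -- forward letter: `tstep = Y(x, μ) = φ x − Ad_{V₀(x,μ)}φ(x + e_μ)`, `g = V₀(x, μ)`
      have hg : stepHol V₀ x (μ, true) = V₀ x μ := by unfold stepHol; simp
      unfold tstep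
      simp only [↓reduceIte]
      rw [hY, hg, B7Prop1Explicit.Letter.vec_true]
      abel

/-- On a CLOSED word (`disp Γ = 0`): `(R_{0,x}Y)(Γ) = φ(x) − Ad_{V₀(Γ)}φ(x) = [1 − Ad_{V₀(Γ)}]φ(x)`. [cite: Balaban1985Averaging, (58) p.27] -/
theorem tsum_covGrad_of_disp_eq_zero (V₀ : Site d → Fin d → 𝔸ˣ) (φ : Site d → 𝔸) (Y : Site d → Fin d → 𝔸)
    (hY : ∀ x μ, Y x μ = φ x - conjR (V₀ x μ) (φ (x + e μ))) (x : Site d) (w : List (Letter d)) (hw : disp w = 0) :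
    tsum V₀ Y x w = φ x - conjR (hol V₀ x w) (φ x) := by
  rw [tsum_covGrad V₀ φ Y hY x w, hw, add_zero]

/-! ## §2 The block loops and the straight segment -/

/-- The block loop `Γ_{c,x_r} ∪ (−c)` of (42) is closed and its holonomy is `W₀,r = V₀(Γ_{c,x_r})V₀(c)⁻¹` (lit `Wcx_eq_hol_loop`):
`(R_{0,c₋}Y)(Γ_{c,x_r} ∪ (−c)) = φ(c₋) − Ad_{W₀,r}φ(c₋)`. [cite: Balaban1985Averaging, (42) p.23, (58) p.27] -/
theorem tsum_covGrad_loop (L : ℕ) (V₀ : Site d → Fin d → 𝔸ˣ) (φ : Site d → 𝔸) (Y : Site d → Fin d → 𝔸)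
    (hY : ∀ x μ, Y x μ = φ x - conjR (V₀ x μ) (φ (x + e μ))) (q : Site d) (κ : Fin d) (r : Site d) :
    tsum V₀ Y q (gammaWord L κ r ++ seg κ (-(L : ℤ))) = φ q - conjR (Wcx L V₀ q κ r) (φ q) := by
  rw [tsum_covGrad_of_disp_eq_zero V₀ φ Y hY q _ (by simp [B7Prop1Explicit.disp_gammaWord]), ← Wcx_eq_hol_loop]

/-- The straight segment `[c₋, c₊]`: `(R_{0,c₋}Y)([c₋, c₊]) = φ(c₋) − Ad_{V₀([c₋,c₊])}φ(c₊)`, `c₊ = c₋ + L•e_κ`. [cite: Balaban1985Averaging, (58) p.27] -/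
theorem tsum_covGrad_seg (L : ℕ) (V₀ : Site d → Fin d → 𝔸ˣ) (φ : Site d → 𝔸) (Y : Site d → Fin d → 𝔸)
    (hY : ∀ x μ, Y x μ = φ x - conjR (V₀ x μ) (φ (x + e μ))) (q : Site d) (κ : Fin d) :
    tsum V₀ Y q (seg κ (L : ℤ)) = φ q - conjR (hol V₀ q (seg κ (L : ℤ))) (φ (q + (L : ℤ) • e κ)) := by
  rw [tsum_covGrad V₀ φ Y hY, B7Prop1Explicit.disp_seg]

end Telescoping

section Exactness

variable {d : ℕ} {𝔸 : Type*} [CStarAlgebra 𝔸]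

/-! ## §3 ★★★ The true one-step derivative is exact on pure gauges -/

/-- ★★★ **EXACTNESS OF THE CORNERED TRUE DERIVATIVE ON PURE GAUGES**: for any site field `φ`, its covariant gradient `Y = ∇^{V₀}φ`, and any `L`-bond `c = (q, κ)` whose block
loops are in the unit window of the series logarithm, the one-step operator of ✓`norm_tild_sub_one_sub_trueLin_le` gives EXACTLY the covariant coarse gradient:
`D eml(W₀)[r ↦ (R_{0,q}Y)(loop_r)·W₀,r]·κ₀⁻¹ + κ₀·(R_{0,q}Y)([c₋,c₊])·κ₀⁻¹ = φ(q) − Ad_{V̄₀(c)}φ(q + L•e_κ)` (`κ₀ = exp X_c[V₀]`, `V̄₀(c) = κ₀·V₀([c₋,c₊])` by (42)) —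
print's (11) «`(Ūᵘ)_c = u(c₋)Ū_c u⁻¹(c₊)`» linearised, the comb twin of ✓`Prop7TrueLinPureGauge.trueLin_pureGauge`. «(O2) groundwork — not consumed by any displayed row before the freeze lifts.»
[cite: Balaban1985Averaging, (11) p.19, (42) p.23, (119)-(120) p.35; Balaban1984PropagatorsI, (1.20) p.20; Balaban1987RG1, (0.6) p.253] -/
theorem trueLin_covGrad_eq (L : ℕ) (V₀ : Site d → Fin d → 𝔸ˣ) (φ : Site d → 𝔸) (Y : Site d → Fin d → 𝔸)
    (hY : ∀ x μ, Y x μ = φ x - conjR (V₀ x μ) (φ (x + e μ))) (q : Site d) (κ : Fin d)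
    (hW : ∀ r : Fin d → Fin L, ‖((Wcx L V₀ q κ (boxVec L r) : 𝔸ˣ) : 𝔸) - 1‖ < 1) :
    fderiv ℂ (eml : ((Fin d → Fin L) → 𝔸) → 𝔸) (fun r => ((Wcx L V₀ q κ (boxVec L r) : 𝔸ˣ) : 𝔸))
          (fun r => tsum V₀ Y q (gammaWord L κ (boxVec L r) ++ seg κ (-(L : ℤ))) * ((Wcx L V₀ q κ (boxVec L r) : 𝔸ˣ) : 𝔸))
          * (((expUnit (Xavg L V₀ q κ))⁻¹ : 𝔸ˣ) : 𝔸)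
        + ((expUnit (Xavg L V₀ q κ) : 𝔸ˣ) : 𝔸) * tsum V₀ Y q (seg κ (L : ℤ)) * (((expUnit (Xavg L V₀ q κ))⁻¹ : 𝔸ˣ) : 𝔸)
      = φ q - conjR (bavg L V₀ q κ) (φ (q + (L : ℤ) • e κ)) := by
  -- letters
  set W₀ : (Fin d → Fin L) → 𝔸 := fun r => ((Wcx L V₀ q κ (boxVec L r) : 𝔸ˣ) : 𝔸) with hW₀
  set κ₀u : 𝔸ˣ := expUnit (Xavg L V₀ q κ) with hκ₀u
  set S₀u : 𝔸ˣ := hol V₀ q (seg κ (L : ℤ)) with hS₀u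
  -- (i)+(ii): the loop direction is the commutator direction `r ↦ φ·W₀,r − W₀,r·φ`
  have hdir : (fun r => tsum V₀ Y q (gammaWord L κ (boxVec L r) ++ seg κ (-(L : ℤ))) * W₀ r) = fun r => φ q * W₀ r - W₀ r * φ q := by
    funext r
    rw [tsum_covGrad_loop L V₀ φ Y hY q κ (boxVec L r), sub_mul, conjR_apply, hW₀]
    simp only
    rw [mul_assoc (((Wcx L V₀ q κ (boxVec L r) : 𝔸ˣ) : 𝔸) * φ q), Units.inv_mul, mul_one]
  have hcomm : fderiv ℂ (eml : ((Fin d → Fin L) → 𝔸) → 𝔸) W₀ (fun r => φ q * W₀ r - W₀ r * φ q) = φ q * eml W₀ - eml W₀ * φ q :=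
    fderiv_eml_comm_of_norm_sub_one_lt W₀ (fun r => hW r) (φ q)
  have hκ₀ : (κ₀u : 𝔸) = eml W₀ := by rw [hκ₀u, coe_expUnit_Xavg_eq_eml]
  -- (iii): the segment term and `V̄₀(c) = κ₀·V₀([c₋,c₊])`
  have hseg := tsum_covGrad_seg L V₀ φ Y hY q κ
  have hbavg : bavg L V₀ q κ = κ₀u * S₀u := by rw [hκ₀u, hS₀u, bavg]
  rw [hdir, hcomm, ← hκ₀, hseg, hbavg, conjR_mul_left, conjR_apply κ₀u, ← hS₀u]
  have hu : (κ₀u : 𝔸) * ((κ₀u⁻¹ : 𝔸ˣ) : 𝔸) = 1 := Units.mul_inv κ₀u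
  -- `(φκ₀ − κ₀φ)κ₀⁻¹ + κ₀(φ − Ad_{S₀}φ')κ₀⁻¹ = φ·(κ₀κ₀⁻¹) − κ₀·Ad_{S₀}φ'·κ₀⁻¹`
  have e1 : (φ q * (κ₀u : 𝔸) - (κ₀u : 𝔸) * φ q) * ((κ₀u⁻¹ : 𝔸ˣ) : 𝔸)
        + (κ₀u : 𝔸) * (φ q - conjR S₀u (φ (q + (L : ℤ) • e κ))) * ((κ₀u⁻¹ : 𝔸ˣ) : 𝔸)
      = φ q * ((κ₀u : 𝔸) * ((κ₀u⁻¹ : 𝔸ˣ) : 𝔸)) - (κ₀u : 𝔸) * conjR S₀u (φ (q + (L : ℤ) • e κ)) * ((κ₀u⁻¹ : 𝔸ˣ) : 𝔸) := by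
    noncomm_ring
  rw [e1, hu, mul_one]

/-- ★★ **THE SAME AT LEVEL `j → j+1` OF PRINT's COMB TOWER**: `V₀ := Ū₀ʲ = avgIter L U₀ j`, corner `q = L•z`; the right side is the covariant coarse gradient
`φ(L•z) − Ad_{Ū₀ʲ⁺¹(z,κ)}φ(L•z + L•e_κ)` through lit ✓`avgIter_succ` (`Ū₀ʲ⁺¹(z,κ) = bavg L Ū₀ʲ (L•z) κ`). «(O2) groundwork.» [cite: Balaban1985Averaging, (11) p.19, (43) p.24, (119)-(120) p.35] -/
theorem trueLin_covGrad_eq_level (L : ℕ) (U₀ : Site d → Fin d → 𝔸ˣ) (j : ℕ) (φ : Site d → 𝔸) (Y : Site d → Fin d → 𝔸)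
    (hY : ∀ x μ, Y x μ = φ x - conjR (avgIter L U₀ j x μ) (φ (x + e μ))) (z : Site d) (κ : Fin d)
    (hW : ∀ r : Fin d → Fin L, ‖((Wcx L (avgIter L U₀ j) ((L : ℤ) • z) κ (boxVec L r) : 𝔸ˣ) : 𝔸) - 1‖ < 1) :
    fderiv ℂ (eml : ((Fin d → Fin L) → 𝔸) → 𝔸) (fun r => ((Wcx L (avgIter L U₀ j) ((L : ℤ) • z) κ (boxVec L r) : 𝔸ˣ) : 𝔸))
          (fun r => tsum (avgIter L U₀ j) Y ((L : ℤ) • z) (gammaWord L κ (boxVec L r) ++ seg κ (-(L : ℤ)))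
            * ((Wcx L (avgIter L U₀ j) ((L : ℤ) • z) κ (boxVec L r) : 𝔸ˣ) : 𝔸))
          * (((expUnit (Xavg L (avgIter L U₀ j) ((L : ℤ) • z) κ))⁻¹ : 𝔸ˣ) : 𝔸)
        + ((expUnit (Xavg L (avgIter L U₀ j) ((L : ℤ) • z) κ) : 𝔸ˣ) : 𝔸) * tsum (avgIter L U₀ j) Y ((L : ℤ) • z) (seg κ (L : ℤ))
          * (((expUnit (Xavg L (avgIter L U₀ j) ((L : ℤ) • z) κ))⁻¹ : 𝔸ˣ) : 𝔸)
      = φ ((L : ℤ) • z) - conjR (avgIter L U₀ (j + 1) z κ) (φ ((L : ℤ) • z + (L : ℤ) • e κ)) := by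
  rw [trueLin_covGrad_eq L (avgIter L U₀ j) φ Y hY ((L : ℤ) • z) κ hW, avgIter_succ, rescale_apply]

end Exactness

end Summit.QuantumFields.YangMills.Theorems.Prop7CombTildPureGauge

end
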